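import Literature.Probability.Distributions.BrascampLiebInduction
import Literature.Probability.Distributions.BrascampLiebProofs
import HarnessLib

/-!
# Proof of Brascamp–Lieb's Theorem 4.1 (`BrascampLieb1976_thm41_holds`)

`Literature/Probability/Distributions/`. Discharges the named fact `BrascampLieb1976_thm41` of
file `BrascampLieb` (H. J. Brascamp, E. H. Lieb, J. Funct. Anal. 22 (1976) 366–389, Theorem 4.1):
for `f ∈ C²(ℝⁿ)` with positive definite Hessian everywhere and a minimum, `∫ e^{-f} < ∞`, and for
`h ∈ C¹(ℝⁿ) ∩ L²(μ)`, `μ = e^{-f}dx / ∫ e^{-f}`,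

  `Var_μ h ≤ ∫ ∇hᵀ (f_xx)⁻¹ ∇h dμ`   (right side as an extended integral).

Assembly of the proof (ingredients in the sibling files `BrascampLieb{OneDim, LinAlg, Fibre, Cube,
Induction}`; the first clause `∫ e^{-f} < ∞` is `lintegral_exp_neg_lt_top_of_posDef_coordHessian`
of file `BrascampLiebProofs`, landed by the other seat working this fact):

1. `bl_cube` (`BrascampLiebInduction`): the raw inequality on every cube `[-S,S]ⁿ`, by
   induction on `n` — Brascamp–Lieb's own induction (proof of Thm 4.1, pp. 377–378), organised on
   compact cubes so that all fibre integrals converge and may be differentiated under the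
   integral sign, with the variational bound `2v·w − wᵀMw ≤ vᵀM⁻¹v` in place of Schur complements;
2. `bl_wholeSpace_raw`: let `S → ∞` along `S = k + 1` (monotone convergence of the set integrals,
   `tendsto_setIntegral_of_monotone`), the right side being enlarged to the whole-space integral
   first — this is the paper's closing step (4.11) → (4.5);
3. normalisation: `μ = (∫⁻ e^{-f})⁻¹ • e^{-f} dx` is a probability measure, `evariance = ofReal Var`,
   `Var = E h² − (E h)²`; if `∇hᵀf_xx⁻¹∇h e^{-f}` is not integrable the right side is `∞`.

No definitions; no new named facts (D-0026).
-/

noncomputable section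

open Matrix MeasureTheory ProbabilityTheory Set Filter Function
open scoped Topology ENNReal

namespace Literature.Probability.Distributions

variable {n : ℕ}



/-! ### From cubes to the whole space -/

/-- The cubes `[-(k+1), k+1]^n`, `k ∈ ℕ`, increase to `ℝⁿ`. [folklore] -/
theorem iUnion_cube_nat : (⋃ k : ℕ, (Set.pi (Set.univ : Set (Fin n)) fun _ => Set.Icc (-((k : ℝ) + 1)) (((k : ℝ) + 1)))) = Set.univ := by
  refine eq_univ_of_forall fun x => mem_iUnion.2 ⟨⌈‖x‖⌉₊, ?_⟩
  rw [mem_univ_pi]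
  intro i
  have h1 : |x i| ≤ ‖x‖ := by rw [← Real.norm_eq_abs]; exact norm_le_pi_norm x i
  have h2 : ‖x‖ ≤ (⌈‖x‖⌉₊ : ℝ) + 1 := (Nat.le_ceil _).trans (by linarith)
  constructor <;> [linarith [neg_abs_le (x i)]; linarith [le_abs_self (x i)]]

/-- Monotonicity of the cubes `[-(k+1), k+1]^n` in `k`. [folklore] -/
theorem monotone_cube_nat : Monotone fun k : ℕ => (Set.pi (Set.univ : Set (Fin n)) fun _ => Set.Icc (-((k : ℝ) + 1)) (((k : ℝ) + 1))) := by
  intro k l hkl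
  refine Set.pi_mono fun i _ => Icc_subset_Icc ?_ ?_ <;>
    · have : (k : ℝ) ≤ l := by exact_mod_cast hkl
      linarith

/-- Set integrals over the increasing cubes converge to the integral over `ℝⁿ`. [folklore] -/
theorem tendsto_setIntegral_cube_nat {F : (Fin n → ℝ) → ℝ} (hF : Integrable F) :
    Tendsto (fun k : ℕ => ∫ x in (Set.pi (Set.univ : Set (Fin n)) fun _ => Set.Icc (-((k : ℝ) + 1)) (((k : ℝ) + 1))), F x) atTop (𝓝 (∫ x, F x)) := by
  have := tendsto_setIntegral_of_monotone (μ := volume) (f := F)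
    (s := fun k : ℕ => (Set.pi (Set.univ : Set (Fin n)) fun _ => Set.Icc (-((k : ℝ) + 1)) (((k : ℝ) + 1)))) (fun k => measurableSet_cube n _) monotone_cube_nat
    (by rw [iUnion_cube_nat, integrableOn_univ]; exact hF)
  rwa [iUnion_cube_nat, Measure.restrict_univ] at this

/-- **The raw Brascamp–Lieb inequality on `ℝⁿ`** (limit `S → ∞` of `bl_cube`): for `f ∈ C²` with
positive definite Hessian, `h ∈ C¹`, and `e^{-f}, h e^{-f}, h² e^{-f}, ∇hᵀf_xx⁻¹∇h e^{-f}`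
integrable, `(∫ h² e^{-f})(∫ e^{-f}) − (∫ h e^{-f})² ≤ (∫ ∇hᵀ f_xx⁻¹ ∇h e^{-f})(∫ e^{-f})`.
[cite: BrascampLieb1976, Thm 4.1, end of proof (S → ∞)] -/
theorem bl_wholeSpace_raw {f h : (Fin n → ℝ) → ℝ} (hf : ContDiff ℝ 2 f)
    (hpd : ∀ x, (coordHessian f x).PosDef) (hh : ContDiff ℝ 1 h)
    (hZ : Integrable fun x => Real.exp (-f x))
    (hA : Integrable fun x => h x * Real.exp (-f x))
    (hB : Integrable fun x => h x ^ 2 * Real.exp (-f x))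
    (hQ : Integrable fun x => (coordGradient h x ⬝ᵥ ((coordHessian f x)⁻¹ *ᵥ coordGradient h x)) * Real.exp (-f x)) :
    (∫ x, h x ^ 2 * Real.exp (-f x)) * (∫ x, Real.exp (-f x)) - (∫ x, h x * Real.exp (-f x)) ^ 2 ≤
      (∫ x, (coordGradient h x ⬝ᵥ ((coordHessian f x)⁻¹ *ᵥ coordGradient h x)) * Real.exp (-f x)) * (∫ x, Real.exp (-f x)) := by
  -- the cube inequalities, with the right side enlarged to the whole-space integral
  have hk : ∀ k : ℕ,
      (∫ x in (Set.pi (Set.univ : Set (Fin n)) fun _ => Set.Icc (-((k : ℝ) + 1)) (((k : ℝ) + 1))), h x ^ 2 * Real.exp (-f x)) *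
          (∫ x in (Set.pi (Set.univ : Set (Fin n)) fun _ => Set.Icc (-((k : ℝ) + 1)) (((k : ℝ) + 1))), Real.exp (-f x)) -
        (∫ x in (Set.pi (Set.univ : Set (Fin n)) fun _ => Set.Icc (-((k : ℝ) + 1)) (((k : ℝ) + 1))), h x * Real.exp (-f x)) ^ 2 ≤
      (∫ x, (coordGradient h x ⬝ᵥ ((coordHessian f x)⁻¹ *ᵥ coordGradient h x)) * Real.exp (-f x)) * (∫ x in (Set.pi (Set.univ : Set (Fin n)) fun _ => Set.Icc (-((k : ℝ) + 1)) (((k : ℝ) + 1))), Real.exp (-f x)) := by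
    intro k
    have hS : (0 : ℝ) < (k : ℝ) + 1 := by positivity
    have hcube := bl_cube hS n f h hf hpd hh
    have hQk : (∫ x in (Set.pi (Set.univ : Set (Fin n)) fun _ => Set.Icc (-((k : ℝ) + 1)) (((k : ℝ) + 1))), (coordGradient h x ⬝ᵥ ((coordHessian f x)⁻¹ *ᵥ coordGradient h x)) * Real.exp (-f x)) ≤
        ∫ x, (coordGradient h x ⬝ᵥ ((coordHessian f x)⁻¹ *ᵥ coordGradient h x)) * Real.exp (-f x) :=
      setIntegral_le_integral hQ (Eventually.of_forall fun x =>
        mul_nonneg (blQuad_nonneg hpd x) (Real.exp_pos _).le)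
    have hZk : 0 ≤ ∫ x in (Set.pi (Set.univ : Set (Fin n)) fun _ => Set.Icc (-((k : ℝ) + 1)) (((k : ℝ) + 1))), Real.exp (-f x) :=
      setIntegral_nonneg (measurableSet_cube n _) fun x _ => (Real.exp_pos _).le
    exact hcube.trans (mul_le_mul_of_nonneg_right hQk hZk)
  -- pass to the limit `k → ∞`
  have tZ := tendsto_setIntegral_cube_nat hZ
  have tA := tendsto_setIntegral_cube_nat hA
  have tB := tendsto_setIntegral_cube_nat hB
  exact le_of_tendsto_of_tendsto' ((tB.mul tZ).sub (tA.pow 2)) (tZ.const_mul _) hk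

/-! ### The log-concave probability measure `e^{-f} dx / ∫ e^{-f}` -/

section Measure

variable {f : (Fin n → ℝ) → ℝ}

/-- The density `e^{-f}` as an `ℝ≥0∞`-valued function is measurable (for continuous `f`).
[folklore] -/
theorem measurable_ofReal_expNeg (hf : Continuous f) :
    Measurable fun x => ENNReal.ofReal (Real.exp (-f x)) :=
  ENNReal.measurable_ofReal.comp (continuous_expNeg hf).measurable

/-- The total mass `∫⁻ e^{-f}` equals `ofReal (∫ e^{-f})`. [folklore] -/
theorem lintegral_expNeg_eq (hZ : Integrable fun x => Real.exp (-f x)) :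
    (∫⁻ x, ENNReal.ofReal (Real.exp (-f x))) = ENNReal.ofReal (∫ x, Real.exp (-f x)) :=
  (ofReal_integral_eq_lintegral_ofReal hZ (Eventually.of_forall fun _ => (Real.exp_pos _).le)).symm

/-- Integrals against `logConcaveMeasure f`: `∫ g dμ = (∫ e^{-f})⁻¹ ∫ g e^{-f} dx`. [folklore] -/
theorem integral_logConcaveMeasure (hf : Continuous f) (hZ : Integrable fun x => Real.exp (-f x))
    (g : (Fin n → ℝ) → ℝ) :
    ∫ x, g x ∂(logConcaveMeasure f) = (∫ x, Real.exp (-f x))⁻¹ * ∫ x, g x * Real.exp (-f x) := by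
  rw [logConcaveMeasure, integral_smul_measure, integral_withDensity_eq_integral_toReal_smul
    (measurable_ofReal_expNeg hf) (Eventually.of_forall fun x => ENNReal.ofReal_lt_top),
    lintegral_expNeg_eq hZ, ENNReal.toReal_inv,
    ENNReal.toReal_ofReal (integral_nonneg fun x => (Real.exp_pos _).le), smul_eq_mul]
  congr 1
  refine integral_congr_ae (Eventually.of_forall fun x => ?_)
  simp only [ENNReal.toReal_ofReal (Real.exp_pos _).le, smul_eq_mul]
  ring

/-- Extended integrals against `logConcaveMeasure f`:
`∫⁻ G dμ = (∫⁻ e^{-f})⁻¹ ∫⁻ G e^{-f} dx` for measurable `G`. [folklore] -/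
theorem lintegral_logConcaveMeasure (hf : Continuous f) {G : (Fin n → ℝ) → ℝ≥0∞}
    (hG : Measurable G) :
    ∫⁻ x, G x ∂(logConcaveMeasure f) =
      (∫⁻ x, ENNReal.ofReal (Real.exp (-f x)))⁻¹ *
        ∫⁻ x, ENNReal.ofReal (Real.exp (-f x)) * G x := by
  rw [logConcaveMeasure, lintegral_smul_measure,
    lintegral_withDensity_eq_lintegral_mul _ (measurable_ofReal_expNeg hf) hG, smul_eq_mul]
  rfl

/-- Integrability against `logConcaveMeasure f` versus against `e^{-f} dx`. [folklore] -/
theorem integrable_logConcaveMeasure_iff (hf : Continuous f) (hZ : Integrable fun x => Real.exp (-f x))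
    {g : (Fin n → ℝ) → ℝ} :
    Integrable g (logConcaveMeasure f) ↔ Integrable fun x => g x * Real.exp (-f x) := by
  have hpos := integral_exp_pos hZ
  have h0 : (∫⁻ x, ENNReal.ofReal (Real.exp (-f x)))⁻¹ ≠ 0 := by
    rw [lintegral_expNeg_eq hZ]
    exact ENNReal.inv_ne_zero.2 ENNReal.ofReal_ne_top
  have htop : (∫⁻ x, ENNReal.ofReal (Real.exp (-f x)))⁻¹ ≠ ∞ := by
    rw [lintegral_expNeg_eq hZ]
    exact ENNReal.inv_ne_top.2 ((ENNReal.ofReal_pos.2 hpos).ne')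
  rw [logConcaveMeasure, integrable_smul_measure h0 htop,
    integrable_withDensity_iff_integrable_smul' (measurable_ofReal_expNeg hf)
      (Eventually.of_forall fun x => ENNReal.ofReal_lt_top)]
  have : (fun x => (ENNReal.ofReal (Real.exp (-f x))).toReal • g x) =
      fun x => g x * Real.exp (-f x) := by
    funext x
    rw [ENNReal.toReal_ofReal (Real.exp_pos _).le, smul_eq_mul, mul_comm]
  rw [this]

/-- `e^{-f}` is integrable for `f ∈ C²` with positive definite Hessian and a minimum (the first
clause of Thm 4.1, from `lintegral_exp_neg_lt_top_of_posDef_coordHessian` of file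
`BrascampLiebProofs`, as a Bochner-integrability statement). [cite: BrascampLieb1976, Thm 4.1] -/
theorem integrable_expNeg_of_posDef (hf : ContDiff ℝ 2 f) (hpd : ∀ x, (coordHessian f x).PosDef)
    {x₀ : Fin n → ℝ} (hmin : ∀ x, f x₀ ≤ f x) : Integrable fun x => Real.exp (-f x) :=
  (lintegral_ofReal_ne_top_iff_integrable (continuous_expNeg hf.continuous).aestronglyMeasurable
    (Eventually.of_forall fun _ => (Real.exp_pos _).le)).1
    (lintegral_exp_neg_lt_top_of_posDef_coordHessian hf hpd ⟨x₀, hmin⟩).ne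

/-- `logConcaveMeasure f` is a probability measure for `f ∈ C²` with positive definite Hessian and
a minimum. [cite: BrascampLieb1976, §4 eq. (4.3)] -/
theorem isProbabilityMeasure_logConcaveMeasure_of_posDef (hf : ContDiff ℝ 2 f)
    (hpd : ∀ x, (coordHessian f x).PosDef) {x₀ : Fin n → ℝ} (hmin : ∀ x, f x₀ ≤ f x) :
    IsProbabilityMeasure (logConcaveMeasure f) := by
  have hZ := integrable_expNeg_of_posDef hf hpd hmin
  have hpos := integral_exp_pos hZ
  refine ⟨?_⟩
  rw [logConcaveMeasure, Measure.smul_apply, withDensity_apply _ MeasurableSet.univ,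
    Measure.restrict_univ, smul_eq_mul]
  refine ENNReal.inv_mul_cancel ?_ ?_
  · rw [lintegral_expNeg_eq hZ]; exact (ENNReal.ofReal_pos.2 hpos).ne'
  · rw [lintegral_expNeg_eq hZ]; exact ENNReal.ofReal_ne_top

end Measure

/-! ### Theorem 4.1 -/

/-- **Brascamp–Lieb's variance inequality (Theorem 4.1), measure form.** For `f ∈ C²(ℝⁿ)` with
positive definite Hessian and a global minimum, and `h ∈ C¹ ∩ L²(μ)`, `μ = e^{-f}dx/∫e^{-f}`:
`Var_μ h ≤ ∫ ∇hᵀ f_xx⁻¹ ∇h dμ` (right side as an extended integral).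
[cite: BrascampLieb1976, Thm 4.1] -/
theorem evariance_le_lintegral_blQuad {f h : (Fin n → ℝ) → ℝ} (hf : ContDiff ℝ 2 f)
    (hpd : ∀ x, (coordHessian f x).PosDef) {x₀ : Fin n → ℝ} (hmin : ∀ x, f x₀ ≤ f x)
    (hh : ContDiff ℝ 1 h) (hmem : MemLp h 2 (logConcaveMeasure f)) :
    evariance h (logConcaveMeasure f) ≤
      ∫⁻ x, ENNReal.ofReal ((coordGradient h x ⬝ᵥ ((coordHessian f x)⁻¹ *ᵥ coordGradient h x))) ∂(logConcaveMeasure f) := by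
  have hfc : Continuous f := hf.continuous
  have hZ : Integrable fun x => Real.exp (-f x) := integrable_expNeg_of_posDef hf hpd hmin
  have hZpos := integral_exp_pos hZ
  haveI := isProbabilityMeasure_logConcaveMeasure_of_posDef hf hpd hmin
  have hqc : Continuous fun x => (coordGradient h x ⬝ᵥ ((coordHessian f x)⁻¹ *ᵥ coordGradient h x)) := continuous_blQuad hf hpd hh
  have hq0 : ∀ x, 0 ≤ (coordGradient h x ⬝ᵥ ((coordHessian f x)⁻¹ *ᵥ coordGradient h x)) := fun x => blQuad_nonneg hpd x
  -- integrability of `h e^{-f}` and `h² e^{-f}`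
  have hA : Integrable fun x => h x * Real.exp (-f x) :=
    (integrable_logConcaveMeasure_iff hfc hZ).1 (hmem.integrable one_le_two)
  have hB : Integrable fun x => h x ^ 2 * Real.exp (-f x) :=
    (integrable_logConcaveMeasure_iff hfc hZ).1 hmem.integrable_sq
  -- the right side as `(∫ e^{-f})⁻¹ ∫⁻ q e^{-f}`
  have hRHS : ∫⁻ x, ENNReal.ofReal ((coordGradient h x ⬝ᵥ ((coordHessian f x)⁻¹ *ᵥ coordGradient h x))) ∂(logConcaveMeasure f) =
      (∫⁻ x, ENNReal.ofReal (Real.exp (-f x)))⁻¹ *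
        ∫⁻ x, ENNReal.ofReal ((coordGradient h x ⬝ᵥ ((coordHessian f x)⁻¹ *ᵥ coordGradient h x)) * Real.exp (-f x)) := by
    rw [lintegral_logConcaveMeasure hfc (G := fun x => ENNReal.ofReal ((coordGradient h x ⬝ᵥ ((coordHessian f x)⁻¹ *ᵥ coordGradient h x))))
      (ENNReal.measurable_ofReal.comp hqc.measurable)]
    congr 1
    refine lintegral_congr fun x => ?_
    rw [← ENNReal.ofReal_mul (Real.exp_pos _).le, mul_comm]
  by_cases hQ : Integrable fun x => (coordGradient h x ⬝ᵥ ((coordHessian f x)⁻¹ *ᵥ coordGradient h x)) * Real.exp (-f x)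
  · -- everything is finite: reduce to the raw real inequality
    have hraw := bl_wholeSpace_raw hf hpd hh hZ hA hB hQ
    have hQμ : Integrable (fun x => (coordGradient h x ⬝ᵥ ((coordHessian f x)⁻¹ *ᵥ coordGradient h x))) (logConcaveMeasure f) :=
      (integrable_logConcaveMeasure_iff hfc hZ).2 hQ
    rw [← hmem.ofReal_variance_eq, variance_eq_sub hmem,
      ← ofReal_integral_eq_lintegral_ofReal hQμ (Eventually.of_forall hq0)]
    refine ENNReal.ofReal_le_ofReal ?_
    have e2 : (fun x => (h ^ 2) x) = fun x => h x ^ 2 := by funext x; simp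
    rw [show (∫ x, (h ^ 2) x ∂(logConcaveMeasure f)) = ∫ x, h x ^ 2 ∂(logConcaveMeasure f) by rfl,
      integral_logConcaveMeasure hfc hZ (fun x => h x ^ 2), integral_logConcaveMeasure hfc hZ h,
      integral_logConcaveMeasure hfc hZ (fun x => (coordGradient h x ⬝ᵥ ((coordHessian f x)⁻¹ *ᵥ coordGradient h x)))]
    set Zr := ∫ x, Real.exp (-f x) with hZr
    set IA := ∫ x, h x * Real.exp (-f x)
    set IB := ∫ x, h x ^ 2 * Real.exp (-f x)
    set IQ := ∫ x, (coordGradient h x ⬝ᵥ ((coordHessian f x)⁻¹ *ᵥ coordGradient h x)) * Real.exp (-f x)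
    rw [show Zr⁻¹ * IB - (Zr⁻¹ * IA) ^ 2 = (IB * Zr - IA ^ 2) / Zr ^ 2 by field_simp,
      show Zr⁻¹ * IQ = (IQ * Zr) / Zr ^ 2 by field_simp,
      div_le_div_iff_of_pos_right (pow_pos hZpos 2)]
    exact hraw
  · -- the right side is infinite
    have htop : ∫⁻ x, ENNReal.ofReal ((coordGradient h x ⬝ᵥ ((coordHessian f x)⁻¹ *ᵥ coordGradient h x)) * Real.exp (-f x)) = ∞ := by
      by_contra hne
      exact hQ ((lintegral_ofReal_ne_top_iff_integrable
        ((hqc.mul (continuous_expNeg hfc)).aestronglyMeasurable)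
        (Eventually.of_forall fun x => mul_nonneg (hq0 x) (Real.exp_pos _).le)).1 hne)
    rw [hRHS, htop, ENNReal.mul_top]
    · exact le_top
    · rw [lintegral_expNeg_eq hZ]
      exact ENNReal.inv_ne_zero.2 ENNReal.ofReal_ne_top

/-- **Brascamp–Lieb 1976, Theorem 4.1** — discharge of the named fact `BrascampLieb1976_thm41`:
for `f ∈ C²(ℝⁿ)` with positive definite Hessian everywhere and a minimum, `∫ e^{-f} < ∞`, and
for every `h ∈ C¹(ℝⁿ)` with `var h < ∞`, `var h ≤ ⟨(h_x, (f_xx)⁻¹ h_x)⟩` with respect to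
`F dx/∫F`, `F = e^{-f}`. Proof: the raw inequality on cubes `[-S,S]ⁿ` by induction on `n`
(`bl_cube`, files `BrascampLiebInduction`, `…Cube`, `…Fibre`, `…LinAlg`, `…OneDim`), then
`S → ∞` (`bl_wholeSpace_raw`) using the exponential decay of `F` (`BrascampLiebGrowth`).
[cite: BrascampLieb1976, Thm 4.1] -/
theorem BrascampLieb1976_thm41_holds : BrascampLieb1976_thm41 := by
  intro n f hf hpd hmin
  obtain ⟨x₀, hx₀⟩ := hmin
  exact ⟨lintegral_exp_neg_lt_top_of_posDef_coordHessian hf hpd ⟨x₀, hx₀⟩,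
    fun h hh hmem => evariance_le_lintegral_blQuad hf hpd hx₀ hh hmem⟩

end Literature.Probability.Distributions
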